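import Summits.HodgeConjecture.HodgeConjecture.Theses.BoundaryReadout
import Literature.AlgebraicGeometry.HodgeTheory.MotivatedClassesDeformation
import Literature.AlgebraicGeometry.HodgeTheory.HodgeTypeExteriorProduct
import Literature.AlgebraicGeometry.HodgeTheory.TopDegreeClasses
import Literature.AlgebraicGeometry.Motives.ProjectiveSpaceCells
import Literature.AlgebraicGeometry.Motives.SegreEmbedding
import HarnessLib

/-!
# Route BoundaryReadout — crux `BoundarySupply` (stmt-HodgeConjecture-15912): the constant family

Helper file for the crux item stmt-HodgeConjecture-15912 (it closes nothing: the crux — every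
rational `(p,p)` class is pulled back from a global class on a projective family one fibre of which
is covered by pieces on which the class is ABSOLUTE HODGE — has, inside the route, exactly the
content of Charles–Schnell Conj. 11.2.17 "Hodge classes are absolute Hodge", an open problem).

What is proved here, sorry-free and with no named-fact hypothesis, is the CONSTANT FAMILY of the
route header ("trivially true where `c` is already known absolute — constant family"):

* `exists_sliceFiberIso X t : ∃ e : X ≅ (X × C)_t, …` — the fibre of the projection
  `pr₂ : X × C ⟶ C` over a rational point `t ∈ C(k)` IS `X`, by an isomorphism of `k`-schemes
  whose composite with the fibre inclusion and `pr₁` is the identity; `exists_constFamily` — the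
  constant family `X × ℙ¹ ⟶ ℙ¹` of a smooth projective complex `X` with all its bookkeeping;
* `absoluteSupply` — the statement `AbsoluteSupply` of line `birth` of this crux (its registered
  stub 1 until 2026-08-17, "size L"): for an ABSOLUTE Hodge class `c` on a smooth projective `X` the
  `∃`-block of `BoundarySupply` holds, witnessed by `X × ℙ¹ ⟶ ℙ¹`, `o = t`, one piece `Y = X`,
  `ξ = pr₁^* c`;
* `boundarySupply_of_hodgeClassesAbsolute` — Conj. 11.2.17 (spelled out on the tree's carriers)
  implies the crux; `boundarySupply_of_hodgeConjecture` — the Hodge conjecture and "cycle classes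
  are absolute Hodge" (line birth / qbar-fibre stub 3, spelled out) imply the crux (HC-safety);
* `hodgeClassesAbsolute_of_boundarySupply` — conversely the crux, the route's engine
  `BoundaryAbsoluteness` and stability of absoluteness under pull-back give Conj. 11.2.17: so,
  granted the engine and absolute pull-backs, `BoundarySupply ↔ Conj. 11.2.17`
  (`boundarySupply_iff_hodgeClassesAbsolute`).

The anchor statements of line `qbar-fibre` (`AnchorSupply` from the Hodge conjecture, anchor blocks
for arithmetic varieties and cycle classes) are in the companion file
`BoundaryReadoutBoundarySupplyAnchors`.

## References

* [Hartshorne1977] R. Hartshorne, Algebraic Geometry, II.3 (fibres, base extension), II Ex. 5.11,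
  III Prop. 10.1.
* [CharlesSchnell2014Notes] F. Charles, C. Schnell, Notes on absolute Hodge classes, §11.2.5
  Conj. 11.2.17, §11.3 (Principle B).
* [Deligne1982HodgeCycles] P. Deligne, Hodge cycles on abelian varieties, LNM 900, Thm 2.12.
* [Voisin2007HodgeLoci] C. Voisin, Hodge loci and absolute Hodge classes, Compositio 143 (2007).
-/

-- every declaration of this problem lives in `Summit.HodgeConjecture.HodgeConjecture.…` (summit = sub-problem)
set_option linter.dupNamespace false

noncomputable section

namespace Summit.HodgeConjecture.HodgeConjecture.Theorems

open CategoryTheory CategoryTheory.Limits AlgebraicGeometry MonoidalCategory CartesianMonoidalCategory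
open Literature.AlgebraicTopology.SingularHomology
open Literature.AlgebraicGeometry.Motives Literature.AlgebraicGeometry.HodgeTheory
open Summit.HodgeConjecture.HodgeConjecture.Theses

universe u

/-! ### The fibres of a constant family `pr₂ : X × C ⟶ C` -/

section ConstantFamily

variable {k : Type u} [Field k] (X : SchemeOver k) {C : SchemeOver k} (t : AlgPoints C k)

/-- **The slice isomorphism `X ≅ (X × C)_t`.** The fibre of the constant family
`pr₂ : X × C ⟶ C` over a rational point `t ∈ C(k)` is `X`: both `X × Spec k` and `(X × C)_t` are
the base change of `pr₂` along `t : Spec k ⟶ C` (`isPullback_snd_whiskerLeft` and the defining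
cartesian square of `fiberOver`), and `X ≅ X × Spec k`; the resulting isomorphism of `k`-schemes
followed by the fibre inclusion and `pr₁` is the identity of `X`.
[cite: Hartshorne1977, II.3 (fibre of a morphism)] -/
theorem exists_sliceFiberIso :
    ∃ e : X ≅ fiberOver (snd X C) t, e.hom ≫ fiberι (snd X C) t ≫ fst X C = 𝟙 X := by
  -- `X × Spec k ≅ (X × C)_t`, compatibly with the maps to `X × C`
  let e₁ : X ⊗ specOver k k ≅ fiberOver (snd X C) t :=
    IsPullback.isoIsPullback _ _ (isPullback_snd_whiskerLeft t X).flip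
      (familyPullback.isPullback (snd X C) t)
  have h₁ : e₁.hom ≫ fiberι (snd X C) t = X ◁ t := IsPullback.isoIsPullback_hom_fst _ _ _ _
  refine ⟨(ρ_ X).symm ≪≫ whiskerLeftIso X (AffineLineProduct.specOverSelfIso k).symm ≪≫ e₁, ?_⟩
  simp only [Iso.trans_hom, Iso.symm_hom, whiskerLeftIso_hom, Category.assoc, reassoc_of% h₁,
    whiskerLeft_fst]
  exact rightUnitor_inv_fst X

variable {X} in
/-- Every point of the target of an isomorphism of `k`-schemes is hit. [folklore] -/
theorem exists_iso_hom_left_base_eq {Z : SchemeOver k} (e : X ≅ Z) (x : ↥Z.left) :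
    ∃ y : ↥X.left, e.hom.left.base y = x := by
  refine ⟨e.inv.left.base x, ?_⟩
  rw [← Scheme.Hom.comp_apply, ← Over.comp_left, Iso.inv_hom_id, Over.id_left]
  rfl

/-- `pr₂ : X × C ⟶ C` is surjective on points as soon as `X` is non-empty (base change of the
surjection `X ⟶ Spec k`). [cite: Hartshorne1977, II.3] -/
theorem surjective_snd_left_base [Nonempty ↥X.left] (C : SchemeOver k) :
    Function.Surjective (snd X C).left.base := by
  haveI : Surjective X.hom := ⟨fun q => ⟨Classical.arbitrary _, Subsingleton.elim _ _⟩⟩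
  haveI : Surjective (snd X C).left := inferInstanceAs (Surjective (pullback.snd X.hom C.hom))
  exact (snd X C).left.surjective

end ConstantFamily

/-! ### The constant family `X × ℙ¹ ⟶ ℙ¹` of a smooth projective complex variety -/

section Complex

variable {n : ℕ} {X : SchemeOver ℂ}

/-- `(g ≫ h)^* a = g^* (h^* a)` on elements of `Hⁱ(–(ℂ); ℂ)`. [folklore] -/
theorem complexBetti_map_comp_apply {X' Y : SchemeOver ℂ} (g : X' ⟶ X) (h : X ⟶ Y) (i : ℕ)
    (a : complexBetti Y i) :
    complexBetti.map (g ≫ h) i a = complexBetti.map g i (complexBetti.map h i a) := by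
  rw [complexBetti.map_comp, ModuleCat.comp_apply]

/-- **The constant family.** For `X` smooth projective of dimension `n` over `ℂ` and any class
`c ∈ H²ᵖ(X(ℂ); ℂ)`: the projection `f = pr₂ : 𝒳 = X × ℙ¹ ⟶ ℙ¹` is a surjective morphism from a
smooth projective `(n+1)`-fold onto the smooth projective line, `ξ = pr₁^* c` is a global class
(rational, resp. of type `(p,p)`, when `c` is), and for a complex point `t ∈ ℙ¹(ℂ)` the slice
`e : X ≅ X_t` identifies `X` with the (smooth projective) fibre, with `e^*(ξ|_{X_t}) = c`.
[cite: Hartshorne1977, II.3 and III Prop. 10.1] [cite: VoisinHodgeI2002, §7.3.2] -/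
theorem exists_constFamily (hX : IsSmoothProjective n X) (p : ℕ) (c : complexBetti X (2 * p)) :
    ∃ (𝒳 C : SchemeOver ℂ) (f : 𝒳 ⟶ C) (t : AlgPoints C ℂ) (ξ : complexBetti 𝒳 (2 * p))
      (e : X ≅ fiberOver f t),
      IsSmoothProjective (n + 1) 𝒳 ∧ IsSmoothProjective 1 C ∧ Function.Surjective f.left.base ∧
      (IsRationalClass c → IsRationalClass ξ) ∧
      (IsOfHodgeType n X (2 * p) p p c → IsOfHodgeType (n + 1) 𝒳 (2 * p) p p ξ) ∧
      IsSmoothProjective n (fiberOver f t) ∧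
      (∀ x : ↥(fiberOver f t).left, ∃ y : ↥X.left, e.hom.left.base y = x) ∧
      ∀ {Z : SchemeOver ℂ} (u : Z ⟶ X),
        complexBetti.map (u ≫ e.hom ≫ fiberι f t) (2 * p) ξ = complexBetti.map u (2 * p) c := by
  -- the parameter curve `C = ℙ¹_ℂ` and a complex point `t` of it
  have hC : IsSmoothProjective 1 (projectiveSpace 1 ℂ) := isSmoothProjective_projectiveSpace_holds ℂ 1
  haveI := connectedSpace_complexPoints hC
  obtain ⟨t⟩ : Nonempty (ComplexPoints (projectiveSpace 1 ℂ)) := inferInstance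
  -- `X` is non-empty (it has a complex point), so `pr₂` is surjective
  haveI := connectedSpace_complexPoints hX
  obtain ⟨x₀⟩ : Nonempty (ComplexPoints X) := inferInstance
  haveI : Nonempty ↥X.left := ⟨x₀.pt⟩
  have h𝒳 : IsSmoothProjective (n + 1) (X ⊗ projectiveSpace 1 ℂ) :=
    IsSmoothProjective.tensor_holds hX hC
  obtain ⟨e, he⟩ := exists_sliceFiberIso X t
  refine ⟨X ⊗ projectiveSpace 1 ℂ, projectiveSpace 1 ℂ, snd X _, t,
    complexBetti.map (fst X _) (2 * p) c, e, h𝒳, hC,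
    surjective_snd_left_base X _, fun hc => ?_, fun hpp => ?_,
    hX.of_iso e, exists_iso_hom_left_base_eq e, fun u => ?_⟩
  · exact hc.pullback (AlgPoints.mapContinuous (L := ℂ) (fst X (projectiveSpace 1 ℂ)))
  · exact hpp.map_of_isSmoothProjective h𝒳 hX (fst X _)
  · rw [← complexBetti_map_comp_apply, Category.assoc, Category.assoc, he, Category.comp_id]

/-- **The constant-family block.** For `X` smooth projective of dimension `n`, a rational
`(p,p)`-class `c`, and ANY condition `P` on (dimension, piece, class on the piece) satisfied by
`(n, X, c)` itself, the `∃`-block of the crux `BoundarySupply` — with the conjunct "`ξ|_{Y_i}`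
absolute Hodge" replaced by `P` — holds: `𝒳 = X × ℙ¹ ⟶ ℙ¹`, `o = t`, one piece `Y = X` glued in
by the slice isomorphism, `ξ = pr₁^* c`. [cite: Hartshorne1977, II.3 and III Prop. 10.1] -/
theorem constFamily_block (hX : IsSmoothProjective n X) (p : ℕ) (c : complexBetti X (2 * p))
    (hc : IsRationalClass c) (hpp : IsOfHodgeType n X (2 * p) p p c)
    (P : ℕ → ∀ Y : SchemeOver ℂ, complexBetti Y (2 * p) → Prop) (hP : P n X c) :
    ∃ (N : ℕ) (𝒳 C : SchemeOver ℂ) (f : 𝒳 ⟶ C) (o t : AlgPoints C ℂ) (ι : Type) (_ : Finite ι)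
      (m : ι → ℕ) (Y : ι → SchemeOver ℂ) (g : ∀ i, Y i ⟶ fiberOver f o)
      (ξ : complexBetti 𝒳 (2 * p)) (n' : ℕ) (e : X ⟶ fiberOver f t),
      IsSmoothProjective N 𝒳 ∧ IsSmoothProjective 1 C ∧ Function.Surjective f.left.base ∧
      (∀ i, IsSmoothProjective (m i) (Y i)) ∧
      (∀ x : ↥(fiberOver f o).left, ∃ (i : ι) (y : ↥(Y i).left), (g i).left.base y = x) ∧
      IsRationalClass ξ ∧ IsOfHodgeType N 𝒳 (2 * p) p p ξ ∧
      (∀ i, P (m i) (Y i) (complexBetti.map (g i ≫ fiberι f o) (2 * p) ξ)) ∧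
      IsSmoothProjective n' (fiberOver f t) ∧
      complexBetti.map e (2 * p) (complexBetti.map (fiberι f t) (2 * p) ξ) = c := by
  obtain ⟨𝒳, C, f, t, ξ, e, h𝒳, hC, hf, hξr, hξh, ht, hcov, hslice⟩ := exists_constFamily hX p c
  refine ⟨n + 1, 𝒳, C, f, t, t, Unit, inferInstance, fun _ => n, fun _ => X, fun _ => e.hom, ξ, n,
    e.hom, h𝒳, hC, hf, fun _ => hX, fun x => ?_, hξr hc, hξh hpp, fun _ => ?_, ht, ?_⟩
  · obtain ⟨y, hy⟩ := hcov x
    exact ⟨(), y, hy⟩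
  · have h := hslice (𝟙 X)
    rw [Category.id_comp, complexBetti.map_id] at h
    rw [h]
    exact hP
  · have h := hslice (𝟙 X)
    rw [Category.id_comp, complexBetti.map_id, complexBetti_map_comp_apply] at h
    exact h

/-- **The constant-family anchor** (one-fibre shape): for `X` smooth projective of dimension `n`, a
rational `(p,p)`-class `c`, and ANY condition `Q` on (fibre, class on the fibre) satisfied by every
isomorphic copy `(X', e'^* c)` of `(X, c)` (`e' : X' ≅ X`), there is a family as in the crux with a
SMOOTH projective fibre `X_o` satisfying `Q (X_o, ξ|_{X_o})` and `e^*(ξ|_{X_t}) = c` — the shape of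
the auxiliary statements `QbarFibreAnchor` / `CycleFibreAnchor` of line `qbar-fibre`.
[cite: Hartshorne1977, II.3 and III Prop. 10.1] -/
theorem constFamily_anchor (hX : IsSmoothProjective n X) (p : ℕ) (c : complexBetti X (2 * p))
    (hc : IsRationalClass c) (hpp : IsOfHodgeType n X (2 * p) p p c)
    (Q : ∀ Y : SchemeOver ℂ, complexBetti Y (2 * p) → Prop)
    (hQ : ∀ (X' : SchemeOver ℂ) (e' : X' ≅ X), Q X' (complexBetti.map e'.hom (2 * p) c)) :
    ∃ (N : ℕ) (𝒳 C : SchemeOver ℂ) (f : 𝒳 ⟶ C) (o t : AlgPoints C ℂ) (n₀ : ℕ)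
      (ξ : complexBetti 𝒳 (2 * p)) (n' : ℕ) (e : X ⟶ fiberOver f t),
      IsSmoothProjective N 𝒳 ∧ IsSmoothProjective 1 C ∧ Function.Surjective f.left.base ∧
      IsSmoothProjective n₀ (fiberOver f o) ∧
      Q (fiberOver f o) (complexBetti.map (fiberι f o) (2 * p) ξ) ∧
      IsRationalClass ξ ∧ IsOfHodgeType N 𝒳 (2 * p) p p ξ ∧
      IsSmoothProjective n' (fiberOver f t) ∧
      complexBetti.map e (2 * p) (complexBetti.map (fiberι f t) (2 * p) ξ) = c := by
  obtain ⟨𝒳, C, f, t, ξ, e, h𝒳, hC, hf, hξr, hξh, ht, -, hslice⟩ := exists_constFamily hX p c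
  refine ⟨n + 1, 𝒳, C, f, t, t, n, ξ, n, e.hom, h𝒳, hC, hf, ht, ?_, hξr hc, hξh hpp, ht, ?_⟩
  · have h := hslice e.inv
    rw [e.inv_hom_id_assoc] at h
    rw [h]
    exact hQ _ e.symm
  · have h := hslice (𝟙 X)
    rw [Category.id_comp, complexBetti.map_id, complexBetti_map_comp_apply] at h
    exact h

end Complex

/-! ### `AbsoluteSupply` and the crux from Conj. 11.2.17 / from the Hodge conjecture -/

section Statements

variable {n : ℕ} {X : SchemeOver ℂ}

/-- **`AbsoluteSupply`** — the statement of stub 1 of line `birth` of the crux `BoundarySupply`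
(stmt-HodgeConjecture-15912; text verbatim from `Cruxes/BoundarySupply/Lines/birth.lean §1`): for `X`
smooth projective of dimension `n` and an ABSOLUTE Hodge class `c ∈ H²ᵖ(X(ℂ); ℂ)`, the `∃`-block
of `BoundarySupply` holds for `c` — witnessed by the constant family `X × ℙ¹ ⟶ ℙ¹`, `o = t`, one
piece `Y = X`, `ξ = pr₁^* c` (`constFamily_block` with the piece condition "absolute Hodge"). This
is the formal content of the route header's remark "trivially true where `c` is already known
absolute — constant family". [cite: Hartshorne1977, II Ex. 5.11 and III Prop. 10.1]
[cite: CharlesSchnell2014Notes, Def. 11.2.3] -/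
theorem absoluteSupply :
    ∀ ⦃n : ℕ⦄ ⦃X : Literature.AlgebraicGeometry.Motives.SchemeOver ℂ⦄,
    Literature.AlgebraicGeometry.Motives.IsSmoothProjective n X →
    ∀ (p : ℕ) (c : Literature.AlgebraicGeometry.HodgeTheory.complexBetti X (2 * p)),
      Literature.AlgebraicGeometry.HodgeTheory.IsAbsoluteHodgeClass n X p c →
      ∃ (N : ℕ) (𝒳 C : Literature.AlgebraicGeometry.Motives.SchemeOver ℂ) (f : 𝒳 ⟶ C)
        (o t : Literature.AlgebraicGeometry.Motives.AlgPoints C ℂ) (ι : Type) (_ : Finite ι) (m : ι → ℕ)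
        (Y : ι → Literature.AlgebraicGeometry.Motives.SchemeOver ℂ)
        (g : ∀ i, Y i ⟶ Literature.AlgebraicGeometry.Motives.fiberOver f o)
        (ξ : Literature.AlgebraicGeometry.HodgeTheory.complexBetti 𝒳 (2 * p)) (n' : ℕ)
        (e : X ⟶ Literature.AlgebraicGeometry.Motives.fiberOver f t),
        Literature.AlgebraicGeometry.Motives.IsSmoothProjective N 𝒳 ∧
        Literature.AlgebraicGeometry.Motives.IsSmoothProjective 1 C ∧
        Function.Surjective f.left.base ∧
        (∀ i, Literature.AlgebraicGeometry.Motives.IsSmoothProjective (m i) (Y i)) ∧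
        (∀ x : ↥(Literature.AlgebraicGeometry.Motives.fiberOver f o).left,
          ∃ (i : ι) (y : ↥(Y i).left), (g i).left.base y = x) ∧
        Literature.AlgebraicGeometry.HodgeTheory.IsRationalClass ξ ∧
        Literature.AlgebraicGeometry.HodgeTheory.IsOfHodgeType N 𝒳 (2 * p) p p ξ ∧
        (∀ i, Literature.AlgebraicGeometry.HodgeTheory.IsAbsoluteHodgeClass (m i) (Y i) p
          (Literature.AlgebraicGeometry.HodgeTheory.complexBetti.map
            (CategoryTheory.CategoryStruct.comp (g i) (Literature.AlgebraicGeometry.Motives.fiberι f o))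
            (2 * p) ξ)) ∧
        Literature.AlgebraicGeometry.Motives.IsSmoothProjective n'
          (Literature.AlgebraicGeometry.Motives.fiberOver f t) ∧
        Literature.AlgebraicGeometry.HodgeTheory.complexBetti.map e (2 * p)
          (Literature.AlgebraicGeometry.HodgeTheory.complexBetti.map
            (Literature.AlgebraicGeometry.Motives.fiberι f t) (2 * p) ξ) = c :=
  fun _n _X hX p c habs =>
    constFamily_block hX p c habs.isRationalClass habs.isOfHodgeType
      (fun m Y d => IsAbsoluteHodgeClass m Y p d) habs

/-- **Conj. 11.2.17 ⇒ the crux.** If every rational `(p,p)`-class on every smooth projective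
complex variety is absolute Hodge (Charles–Schnell Conj. 11.2.17, spelled out on the tree's
carriers), then `BoundarySupply` holds (by `absoluteSupply`). So the content of the crux inside
the route is at most Conj. 11.2.17; `hodgeClassesAbsolute_of_boundarySupply` is the converse
modulo the route's engine. [cite: CharlesSchnell2014Notes, §11.2.5 Conj. 11.2.17] -/
theorem boundarySupply_of_hodgeClassesAbsolute
    (h17 : ∀ ⦃n : ℕ⦄ ⦃X : SchemeOver ℂ⦄, IsSmoothProjective n X →
      ∀ (p : ℕ) (c : complexBetti X (2 * p)), IsRationalClass c → IsOfHodgeType n X (2 * p) p p c →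
        IsAbsoluteHodgeClass n X p c) :
    BoundaryReadout.BoundarySupply :=
  fun _n _X hX p c hc hpp => absoluteSupply hX p c (h17 hX p c hc hpp)

/-- **HC-safety of the crux.** The Hodge conjecture together with "cycle classes are absolute
Hodge" (the statement `CycleClassesAbsolute`, registered stub 3 of both lines `birth` and
`qbar-fibre` of this crux, spelled out; theorem in print, Charles–Schnell §11.2.2) implies
`BoundarySupply`: every Hodge class is then algebraic, hence absolute, hence supplied by the
constant family. A CONDITIONAL record (both hypotheses are open in the tree).
[cite: CharlesSchnell2014Notes, §11.2.2 (after Def. 11.2.3) and Conj. 11.2.17] -/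
theorem boundarySupply_of_hodgeConjecture
    (hZ : ∀ ⦃n : ℕ⦄ ⦃X : SchemeOver ℂ⦄, IsSmoothProjective n X →
      ∀ (p : ℕ) (c : complexBetti X (2 * p)), IsRationalClass c → IsOfHodgeType n X (2 * p) p p c →
        c ∈ algebraicClasses X p → IsAbsoluteHodgeClass n X p c)
    (h : _root_.HodgeConjecture) : BoundaryReadout.BoundarySupply :=
  fun _n _X hX p c hc hpp => absoluteSupply hX p c (hZ hX p c hc hpp ((h hX).2 p c hc hpp))

/-! ### Conversely: the crux, the engine and absolute pull-backs give Conj. 11.2.17 -/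

/-- **Crux + engine + absolute pull-backs ⇒ Conj. 11.2.17.** If `BoundarySupply` holds, the route's
engine `BoundaryAbsoluteness` (boundary Principle B) holds, and absolute Hodge classes pull back to
absolute Hodge classes along `ℂ`-morphisms of smooth projective varieties (functoriality of
conjugation, Charles–Schnell §11.2.2 — the `IsAbsoluteHodgeClass` analogue of the route's
`PullbackAlgebraic`), then every rational `(p,p)`-class on a smooth projective complex variety is
absolute Hodge: `c = e^*(ξ|_{X_t})` with `ξ|_{X_t}` absolute by the engine. This is the glue
`closes` of the route with `AbsoluteReduction` removed. [cite: CharlesSchnell2014Notes, §11.2.2 and Conj. 11.2.17]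
[cite: Deligne1982HodgeCycles, Thm 2.12] -/
theorem hodgeClassesAbsolute_of_boundarySupply (hS : BoundaryReadout.BoundarySupply)
    (hB : BoundaryReadout.BoundaryAbsoluteness)
    (hpull : ∀ ⦃n : ℕ⦄ ⦃X : SchemeOver ℂ⦄, IsSmoothProjective n X →
      ∀ ⦃m : ℕ⦄ ⦃W : SchemeOver ℂ⦄, IsSmoothProjective m W →
        ∀ (ι : X ⟶ W) (p : ℕ) (c' : complexBetti W (2 * p)), IsAbsoluteHodgeClass m W p c' →
          IsAbsoluteHodgeClass n X p (complexBetti.map ι (2 * p) c')) :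
    ∀ ⦃n : ℕ⦄ ⦃X : SchemeOver ℂ⦄, IsSmoothProjective n X →
      ∀ (p : ℕ) (c : complexBetti X (2 * p)), IsRationalClass c → IsOfHodgeType n X (2 * p) p p c →
        IsAbsoluteHodgeClass n X p c := by
  intro n X hX p c hc hpp
  obtain ⟨N, 𝒳, C, f, o, t, ι, hι, m, Y, g, ξ, n', e, h𝒳, hC, hf, hY, hcov, hξr, hξh, habs, ht, hc'⟩ :=
    hS hX p c hc hpp
  haveI : Finite ι := hι
  have key := hB N p 𝒳 C f o h𝒳 hC hf ι m Y g hY hcov ξ hξr hξh habs t n' ht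
  rw [← hc']
  exact hpull hX ht e p _ key

/-- **Granted the engine and absolute pull-backs, the crux IS Conj. 11.2.17**: under
`BoundaryAbsoluteness` and pull-back stability of absolute Hodge classes, `BoundarySupply` holds
iff every rational `(p,p)`-class on every smooth projective complex variety is absolute Hodge
(`hodgeClassesAbsolute_of_boundarySupply` and `boundarySupply_of_hodgeClassesAbsolute`). This pins
the content of the crux inside the route: exactly "Hodge ⇒ absolute Hodge".
[cite: CharlesSchnell2014Notes, §11.2.5 Conj. 11.2.17] -/
theorem boundarySupply_iff_hodgeClassesAbsolute (hB : BoundaryReadout.BoundaryAbsoluteness)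
    (hpull : ∀ ⦃n : ℕ⦄ ⦃X : SchemeOver ℂ⦄, IsSmoothProjective n X →
      ∀ ⦃m : ℕ⦄ ⦃W : SchemeOver ℂ⦄, IsSmoothProjective m W →
        ∀ (ι : X ⟶ W) (p : ℕ) (c' : complexBetti W (2 * p)), IsAbsoluteHodgeClass m W p c' →
          IsAbsoluteHodgeClass n X p (complexBetti.map ι (2 * p) c')) :
    BoundaryReadout.BoundarySupply ↔
      ∀ ⦃n : ℕ⦄ ⦃X : SchemeOver ℂ⦄, IsSmoothProjective n X →
        ∀ (p : ℕ) (c : complexBetti X (2 * p)), IsRationalClass c →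
          IsOfHodgeType n X (2 * p) p p c → IsAbsoluteHodgeClass n X p c :=
  ⟨fun hS => hodgeClassesAbsolute_of_boundarySupply hS hB hpull,
    boundarySupply_of_hodgeClassesAbsolute⟩

end Statements

end Summit.HodgeConjecture.HodgeConjecture.Theorems

end
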